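import Summits.CriticalPhenomena.PercolationContinuityZ3.Theorems.SahiMasterFamilyPhiVertexSharp
import Summits.CriticalPhenomena.PercolationContinuityZ3.Theorems.SahiMasterFamilyGHConjecture
import Summits.CriticalPhenomena.PercolationContinuityZ3.Theorems.SahiMasterFamilyPhiProduct
import Summits.CriticalPhenomena.PercolationContinuityZ3.Theorems.SahiMasterFamilyPrincipalCapLeSix
import Summits.CriticalPhenomena.PercolationContinuityZ3.Theorems.SahiMasterFamilyPsiSym

/-!
# Conjecture H♯ — "`Φ` does not increase, on average, when a uniformly random index is capped" — on the union-closed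
# hull: typed, reduced to by `(UC-hull)_k`, proved at the vertices (every order) and for `k ≤ 2`

Unit `prim-masterthm-p4` (gen 17; crux anchor stmt-CriticalPhenomena-4575, helper work; memo
`run/shared/lean/prim/prim-masterthm/prim-masterthm-p4/P4-GEN17-REPORT.md` §3).  Companion of `…GHConjecture` (`UCHullNonneg k` =
(UC-hull)_k ⟹ (GH)_k ⟺ PC-k = Sahi's `C_k` on the principal-cap stratum), `…PhiVertexSharp` / `…PhiCapClosedForm` (gen 17: the sharp
abstract step `0 ≤ Φ(cap β) ≤ Φ(β)` and `Φ_{k+1}(cap β) = Σ_{σ∈S_k}∏_{c}(1 − β_c)`).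

For `β : Finset (Fin k) → ℝ` and an index `t` write `cap_t β := (S ↦ 1 if t ∈ S, β_S otherwise)`.  At a VERTEX `β = 1_𝒰` (𝒰 union-closed
∋ univ) gen 17 proved `Φ(cap_t β) ≤ Φ(β)` for EVERY `t` (`PhiVertexSharp.phiSet_indicator_capFamily_le_of_mem`).  On the hull
`P_UC(k) = conv{1_𝒰}` this pointwise-in-`t` statement FAILS (memo §3: k = 3, 12 of 3000 random mixtures), but its AVERAGE over `t`
survives every test so far:

**CONJECTURE H♯(k)** (`HSharpNonneg k`, conjecture-valued definition, never a fact):  for every finite mixture `β` of indicator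
functions of union-closed families containing `univ`,  **`Σ_{t} Φ_k(cap_t β) ≤ k · Φ_k(β)`**.  Equivalently (`…PhiCapClosedForm`)
`(k−1)·Σ_t W_{[k]∖t}(d) ≥ k·W_{[k]}(d)` for the permutation partition function `W_R(d) = Σ_{σ∈Sym R}∏_c d_c`, `d = 1 − β`; equivalently
`Σ_{∅≠B⊊[k]} |B|!·d_B·Φ_{[k]∖B}(β|) ≥ 0`.  EVIDENCE (memo §3): all EDGES of `P_UC(4)` (165 orbit representatives × 2 271 families ×
17 points, min `−5·10⁻¹⁵`, kit j168200), 4·10⁵ / 6·10⁴ random edges of `P_UC(5)` / `P_UC(6)` (j168201/2), adversarial hill-climbing over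
mixtures of ≤ 5 families `k = 4,…,7` (j168203, 0 violations, minima = 0 at tight vertices), every topped restriction included; tight at
the free vertex, at the complementary pairs `{A, Aᶜ, univ}` and on the two-free-indices faces.  A TUPLE-LEVEL version (polarisation:
`k·Ψ^sym_T(𝒢_1,…,𝒢_k) ≥ Σ_t N^sym_{T∖t}(𝒢)`, uniform random injection of cycles into slots; memo §3(c)) is also clean in random
k-tuples (k = 3,4,5) and implies H♯ by averaging over i.i.d. slot labels.  **It is FALSE on the LINEAR
relaxation `F^UC(5)`** (box + all covering inequalities): `5Φ_5 − Σ_t W = −245/243` at the size profile `d = (1/3, 2/3, 1, 0)`, a point cut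
off from `P_UC(5)` by the mixed-level inequality `Σ_i β_{i} ≤ 2 + Σ_{|S|=3} β_S` (kit j168142) — so H♯, unlike `(UC-hull)_k` for `k ≤ 7`,
cannot be certified by covering inequalities: it sees the fine structure of the union-closed polytope.
[status: open for k ≥ 3; numerically clean k ≤ 6; vertices every k and k ≤ 2 proved below]

**APPENDED (gen 17, same day):** `THSharpNonneg n` (the injective polarisation of H♯, via `PsiSym.polar`) and
`hSharpNonneg_of_thSharpNonneg : THSharpNonneg n → HSharpNonneg n` (`PsiSym.phiSet_mixture_eq`), `ucHullNonneg_of_thSharpNonneg`.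

**THEOREMS (this file).** `ucHullNonneg_of_hSharpNonneg : HSharpNonneg k → UCHullNonneg k` (each `Φ(cap_t β) = W(d) ≥ 0` on the box,
`phiSet_capAt_nonneg`); `hSharp_vertex` (H♯ at every vertex, every order, from the sharp step); `hSharpNonneg_one`, `hSharpNonneg_two`.
HONEST FRAMING: H♯ is a STRENGTHENING of (UC-hull)_k offered as an inductive target (it is a two-level statement: two caps kill `Φ`,
`PhiCapClosedForm.phiSet_eq_zero_of_two_free'`); nothing here proves (UC-hull)_k for any new k; Sahi's `C_k` (k ≥ 8 on the principal-cap
stratum), Kahn's Conjecture 5 and the master theorem remain OPEN.  Axioms standard. [this work]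
-/

noncomputable section

open scoped Classical

namespace Summit.CriticalPhenomena.PercolationContinuityZ3.Theorems

namespace HSharp

open Finset Function Equiv
open Literature.Combinatorics.Sahi2008
open PrincipalCapBeta (phiSet)
open GHConjecture (UCHullNonneg)

/-- **Conjecture H♯(k)** — on the union-closed hull, capping a uniformly random index does not increase `Φ_k` on average:
`Σ_t Φ_k(cap_t β) ≤ k·Φ_k(β)` for every finite mixture `β` of indicators of union-closed families containing `univ`.
A conjecture-valued definition, never a fact. [this work] [status: open k ≥ 3; clean on all edges of P_UC(4) and in random mixtures
k ≤ 6; FALSE on the linear relaxation F^UC(5)] -/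
@[conjecture] def HSharpNonneg (k : ℕ) : Prop :=
  ∀ (α : Type) [Fintype α] (w : α → ℝ) (𝒰 : α → Finset (Finset (Fin k))),
    (∀ x, 0 ≤ w x) → ∑ x, w x = 1 → (∀ x, ∀ A ∈ 𝒰 x, ∀ A' ∈ 𝒰 x, A ∪ A' ∈ 𝒰 x) → (∀ x, univ ∈ 𝒰 x) →
      ∑ t : Fin k, phiSet k (fun S => if t ∈ S then 1 else ∑ x, w x * (if S ∈ 𝒰 x then (1 : ℝ) else 0)) ≤
        (k : ℝ) * phiSet k (fun S => ∑ x, w x * (if S ∈ 𝒰 x then (1 : ℝ) else 0))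

variable {k : ℕ}

/-! ### Capping at an arbitrary index is free of charge -/

/-- **`Φ_{k+1}(cap_t β) ≥ 0` for every index `t`** whenever `β ≤ 1` (relabel `t ↔ last` by `PhiCert.phiSet_actV`, then
`PhiVertexSharp.phiSet_cap_nonneg`; by `…PhiCapClosedForm` the value is `Σ_σ ∏_c (1 − β_c) = W(d)`). [this work] -/
theorem phiSet_capAt_nonneg (β : Finset (Fin (k + 1)) → ℝ) (h1 : ∀ B, β B ≤ 1) (t : Fin (k + 1)) :
    0 ≤ phiSet (k + 1) (fun S => if t ∈ S then 1 else β S) := by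
  set σ : Perm (Fin (k + 1)) := Equiv.swap t (Fin.last k) with hσ
  have hmem : ∀ S : Finset (Fin (k + 1)), t ∈ S.map σ.toEmbedding ↔ Fin.last k ∈ S := by
    intro S
    rw [Finset.mem_map_equiv]
    have : σ.symm t = Fin.last k := by rw [hσ, Equiv.symm_swap, Equiv.swap_apply_left]
    rw [this]
  have e1 : PhiCert.actV σ (fun S => if t ∈ S then 1 else β S) =
      fun S => if Fin.last k ∈ S then 1 else PhiCert.actV σ β S := by
    funext S
    unfold PhiCert.actV
    simp only [hmem]
  rw [← PhiCert.phiSet_actV σ, e1]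
  exact PhiVertexSharp.phiSet_cap_nonneg _ fun B => h1 _

/-! ### H♯ ⟹ (UC-hull) -/

/-- The mixture set function of a family of union-closed families takes values in `[0,1]` and is `1` at the top. [this work] -/
theorem mixture_le_one {α : Type} [Fintype α] (w : α → ℝ) (𝒰 : α → Finset (Finset (Fin k))) (hw0 : ∀ x, 0 ≤ w x)
    (hw1 : ∑ x, w x = 1) (B : Finset (Fin k)) : (∑ x, w x * (if B ∈ 𝒰 x then (1 : ℝ) else 0)) ≤ 1 :=
  calc (∑ x, w x * (if B ∈ 𝒰 x then (1 : ℝ) else 0)) ≤ ∑ x, w x * 1 :=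
        sum_le_sum fun x _ => mul_le_mul_of_nonneg_left (by split_ifs <;> norm_num) (hw0 x)
    _ = 1 := by rw [← sum_mul, hw1, one_mul]

/-- **H♯(k) ⟹ (UC-hull)_k**: `k·Φ(β) ≥ Σ_t Φ(cap_t β) ≥ 0`. [this work] -/
theorem ucHullNonneg_of_hSharpNonneg (h : HSharpNonneg k) : UCHullNonneg k := by
  intro α _ w 𝒰 hw0 hw1 hUC htop
  rcases Nat.eq_zero_or_pos k with hk | hk
  · subst hk
    exact PhiProduct.phiSet_zero_nonneg _
  · obtain ⟨k', rfl⟩ : ∃ k', k = k' + 1 := ⟨k - 1, (Nat.sub_add_cancel hk).symm⟩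
    have hH := h α w 𝒰 hw0 hw1 hUC htop
    have hsum : 0 ≤ ∑ t : Fin (k' + 1),
        phiSet (k' + 1) (fun S => if t ∈ S then 1 else ∑ x, w x * (if S ∈ 𝒰 x then (1 : ℝ) else 0)) :=
      sum_nonneg fun t _ => phiSet_capAt_nonneg _ (mixture_le_one w 𝒰 hw0 hw1) t
    have hpos : (0 : ℝ) < ((k' + 1 : ℕ) : ℝ) := by exact_mod_cast hk
    nlinarith [hH, hsum, hpos]

/-! ### H♯ at the vertices, every order -/

/-- **H♯ holds at every vertex, every order** (indeed index by index): for a union-closed `𝒰 ∋ univ`,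
`Σ_t Φ(cap_t 1_𝒰) ≤ (k+1)·Φ(1_𝒰)`. [this work] -/
theorem hSharp_vertex (𝒰 : Finset (Finset (Fin (k + 1)))) (hU : ∀ A ∈ 𝒰, ∀ B ∈ 𝒰, A ∪ B ∈ 𝒰) (htop : univ ∈ 𝒰) :
    ∑ t : Fin (k + 1), phiSet (k + 1) (fun S => if t ∈ S then 1 else (if S ∈ 𝒰 then (1 : ℝ) else 0)) ≤
      ((k + 1 : ℕ) : ℝ) * phiSet (k + 1) (fun S => if S ∈ 𝒰 then (1 : ℝ) else 0) := by
  have hterm : ∀ t : Fin (k + 1), phiSet (k + 1) (fun S => if t ∈ S then 1 else (if S ∈ 𝒰 then (1 : ℝ) else 0)) ≤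
      phiSet (k + 1) (fun S => if S ∈ 𝒰 then (1 : ℝ) else 0) := by
    intro t
    have e1 : (fun S : Finset (Fin (k + 1)) => if t ∈ S then (1 : ℝ) else (if S ∈ 𝒰 then (1 : ℝ) else 0)) =
        fun S => if S ∈ 𝒰 ∨ t ∈ S then (1 : ℝ) else 0 := by
      funext S
      by_cases h1 : t ∈ S <;> by_cases h2 : S ∈ 𝒰 <;> simp [h1, h2]
    rw [e1]
    exact (PhiVertexSharp.phiSet_indicator_capFamily_le_of_mem 𝒰 hU htop t).2
  calc ∑ t : Fin (k + 1), phiSet (k + 1) (fun S => if t ∈ S then 1 else (if S ∈ 𝒰 then (1 : ℝ) else 0))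
      ≤ ∑ _t : Fin (k + 1), phiSet (k + 1) (fun S => if S ∈ 𝒰 then (1 : ℝ) else 0) := sum_le_sum fun t _ => hterm t
    _ = ((k + 1 : ℕ) : ℝ) * phiSet (k + 1) (fun S => if S ∈ 𝒰 then (1 : ℝ) else 0) := by
      rw [sum_const, card_univ, Fintype.card_fin, nsmul_eq_mul]

/-- H♯ for a Dirac mixture (one family, weight one) — the typed conjecture's vertex case. [this work] -/
theorem hSharpNonneg_dirac (𝒰 : Finset (Finset (Fin (k + 1)))) (hU : ∀ A ∈ 𝒰, ∀ B ∈ 𝒰, A ∪ B ∈ 𝒰) (htop : univ ∈ 𝒰) :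
    ∑ t : Fin (k + 1), phiSet (k + 1)
        (fun S => if t ∈ S then 1 else ∑ _x : Unit, (1 : ℝ) * (if S ∈ 𝒰 then (1 : ℝ) else 0)) ≤
      ((k + 1 : ℕ) : ℝ) * phiSet (k + 1) (fun S => ∑ _x : Unit, (1 : ℝ) * (if S ∈ 𝒰 then (1 : ℝ) else 0)) := by
  have e : (fun S : Finset (Fin (k + 1)) => ∑ _x : Unit, (1 : ℝ) * (if S ∈ 𝒰 then (1 : ℝ) else 0)) =
      fun S => if S ∈ 𝒰 then (1 : ℝ) else 0 := by
    funext S; simp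
  have e' : ∀ t : Fin (k + 1), (fun S : Finset (Fin (k + 1)) =>
      if t ∈ S then 1 else ∑ _x : Unit, (1 : ℝ) * (if S ∈ 𝒰 then (1 : ℝ) else 0)) =
      fun S => if t ∈ S then 1 else (if S ∈ 𝒰 then (1 : ℝ) else 0) := by
    intro t; funext S; simp
  simp only [e, e']
  exact hSharp_vertex 𝒰 hU htop

/-! ### The two smallest orders -/

/-- H♯(1): both sides equal `1`. [this work] -/
theorem hSharpNonneg_one : HSharpNonneg 1 := by
  intro α _ w 𝒰 hw0 hw1 _ htop
  have huniv : (∑ x, w x * (if (univ : Finset (Fin 1)) ∈ 𝒰 x then (1 : ℝ) else 0)) = 1 := by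
    have : ∀ x, w x * (if (univ : Finset (Fin 1)) ∈ 𝒰 x then (1 : ℝ) else 0) = w x := fun x => by
      rw [if_pos (htop x), mul_one]
    simp only [this, hw1]
  simp only [PrincipalCapBeta.phiSet_one, Fin.sum_univ_one, huniv]
  rw [if_pos (mem_univ _)]
  norm_num

/-- H♯(2): `(1 − β₁) + (1 − β₀) ≤ 2(1 − β₀β₁)` on the box. [this work] -/
theorem hSharpNonneg_two : HSharpNonneg 2 := by
  intro α _ w 𝒰 hw0 hw1 _ htop
  set β : Finset (Fin 2) → ℝ := fun S => ∑ x, w x * (if S ∈ 𝒰 x then (1 : ℝ) else 0) with hβ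
  have h0 : ∀ B, 0 ≤ β B := fun B => sum_nonneg fun x _ => mul_nonneg (hw0 x) (by split_ifs <;> norm_num)
  have h1 : ∀ B, β B ≤ 1 := fun B => mixture_le_one w 𝒰 hw0 hw1 B
  have huniv : β univ = 1 := by
    have : ∀ x, w x * (if (univ : Finset (Fin 2)) ∈ 𝒰 x then (1 : ℝ) else 0) = w x := fun x => by
      rw [if_pos (htop x), mul_one]
    simp only [hβ, this, hw1]
  show ∑ t : Fin 2, phiSet 2 (fun S => if t ∈ S then 1 else β S) ≤ ((2 : ℕ) : ℝ) * phiSet 2 β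
  simp only [PrincipalCapBeta.phiSet_two, Fin.sum_univ_two, Fin.isValue, mem_univ, if_true, mem_singleton,
    Fin.zero_eq_one_iff, OfNat.ofNat_ne_one, one_ne_zero, if_false, huniv]
  have a0 := h0 {0}; have a1 := h0 {1}; have b0 := h1 {0}; have b1 := h1 {1}
  push_cast
  nlinarith [mul_nonneg a0 (sub_nonneg.2 b1), mul_nonneg a1 (sub_nonneg.2 b0)]

/-! ### The tuple-level (polarised) conjecture TH♯ and TH♯ ⟹ H♯ -/

/-- **Conjecture TH♯(n)** — the injective polarisation of H♯: for every `n`-tuple of union-closed families containing `univ`,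
`Σ_t P_n(cap_t 1_{V_0},…,cap_t 1_{V_{n−1}}) ≤ n · P_n(1_{V_0},…,1_{V_{n−1}})` (`P_n` = `PsiSym.polar`, average over injective assignments of
blocks to slots; the left-hand polarisation is the tuple-level count `N^sym_{T∖t}` of all-badly-placed permutations, memo §3b).  A conjecture-valued
definition, never a fact. [this work] [status: open n ≥ 4; EXHAUSTIVE for n = 3 (all 16 215 multisets of families); clean in random tuples n = 4, 5] -/
@[conjecture] def THSharpNonneg (n : ℕ) : Prop :=
  ∀ V : Fin n → Finset (Finset (Fin n)), (∀ r, ∀ A ∈ V r, ∀ A' ∈ V r, A ∪ A' ∈ V r) → (∀ r, univ ∈ V r) →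
    ∑ t : Fin n, PsiSym.polar n (fun r S => if t ∈ S then 1 else (if S ∈ V r then (1 : ℝ) else 0)) ≤
      (n : ℝ) * PsiSym.polar n (fun r S => if S ∈ V r then (1 : ℝ) else 0)

/-- **TH♯(n) ⟹ H♯(n)**: the cap of a mixture is the mixture of the caps, and both sides of H♯ expand by multilinearity
(`PsiSym.phiSet_mixture_eq`) into nonnegative combinations over tuples (with repetitions) of the families. [this work] -/
theorem hSharpNonneg_of_thSharpNonneg {n : ℕ} (h : THSharpNonneg n) : HSharpNonneg n := by
  intro α _ w 𝒰 hw0 hw1 hUC htop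
  have hcap : ∀ t : Fin n, (fun S : Finset (Fin n) => if t ∈ S then (1 : ℝ) else ∑ x, w x * (if S ∈ 𝒰 x then (1 : ℝ) else 0)) =
      fun S => ∑ x, w x * (if t ∈ S then 1 else (if S ∈ 𝒰 x then (1 : ℝ) else 0)) := by
    intro t
    funext S
    by_cases ht : t ∈ S
    · simp only [if_pos ht, mul_one, hw1]
    · simp only [if_neg ht]
  have hL : ∀ t : Fin n, phiSet n (fun S => if t ∈ S then (1 : ℝ) else ∑ x, w x * (if S ∈ 𝒰 x then (1 : ℝ) else 0)) =
      ∑ g : Fin n → α, (∏ r, w (g r)) * PsiSym.polar n (fun r S => if t ∈ S then 1 else (if S ∈ 𝒰 (g r) then (1 : ℝ) else 0)) := by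
    intro t
    rw [hcap t, PsiSym.phiSet_mixture_eq w hw1 fun x S => if t ∈ S then 1 else (if S ∈ 𝒰 x then (1 : ℝ) else 0)]
  rw [PsiSym.phiSet_mixture_eq w hw1 fun x S => if S ∈ 𝒰 x then (1 : ℝ) else 0, sum_congr rfl fun t _ => hL t, sum_comm,
    mul_sum]
  refine sum_le_sum fun g _ => ?_
  rw [← mul_sum, mul_left_comm]
  exact mul_le_mul_of_nonneg_left (h (fun r => 𝒰 (g r)) (fun r => hUC (g r)) fun r => htop (g r))
    (prod_nonneg fun r _ => hw0 _)

/-- TH♯(n) ⟹ (UC-hull)_n (down the ladder). [this work] -/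
theorem ucHullNonneg_of_thSharpNonneg {n : ℕ} (h : THSharpNonneg n) : UCHullNonneg n :=
  ucHullNonneg_of_hSharpNonneg (hSharpNonneg_of_thSharpNonneg h)

end HSharp

end Summit.CriticalPhenomena.PercolationContinuityZ3.Theorems
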